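import Literature.MathematicalPhysics.QuantumFieldTheory.Balaban1983to89.Node00.Record13SignFreeComparabilityOfBetaBox
import Literature.MathematicalPhysics.QuantumFieldTheory.Balaban1983to89.Node00.Record13LiveSelectorFamily

/-!
# DAG node N11 — THE cR-LETTERED MEMBER's ROW-`bg` LETTERS, RE-HOMED OUT OF THE STAGE-2 RESIDUE (director-ym №365 RENAME-AND-REDIRECT): one public BUNDLE over `private` copies

HEADER — WORK-UNIT METADATA.  Cell `pub-ymgap`, YM-PLAN Track A, seat `pub-ymgap-dag-n11-w3` (g6); TRAIN-N11 row 12 (director-ym №343∕№346∕№348 (C)∕№360∕★№365).  `--kind proof --supports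
stmt-QuantumFields-20541 --as helper` (count-neutral).  THEOREMS ONLY (0 `def`).  [III] = [Balaban1988Convergent], [15] = [Balaban1985Variational], [I] = [Balaban1987RG1], [6] =
[Balaban1985RegularSpaces].

WHY THIS FILE.  Under №365 (gate8: `theorems.append-only` stays; CLASS-T re-typing = RENAME-AND-REDIRECT into NEW sibling modules; the old modules become RESIDUE after node00-def-R's seam
edit) this seat's ✓p620936 `Thm/…N11K0DoorAtCRLetteredNumerics` is residue: its §2 reads the seam.  But its §1 — the cR-reading LETTERS of the row-`bg` engine at the member `θ₁₃(n_c, ε₂₉)`,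
`n_c := {θ₁₅ᶜᶜᴹᵂ(j; γ)'s numerics with s2.cR := c}` — is SEAM-INVARIANT arithmetic that every door ∕ row file of the member cone reads (this seat's twins ✓p767835 ∕ ✓p767960, the siblings
of (9)(11)(12) and of the ten consumers).  So the letters are re-homed HERE, residue-free (imports: Literature `Node00/` only): the eleven rows as `private` byte-identical copies (the gate's
`dedup.landed` rule for re-homed copies — PUBLIC copies bounce, `private` pass: k0-s1-w1, cell INBOX 2026-08-30 I.18016) and ONE public BUNDLE `letters_ccmwCR` (a new statement: the
conjunction) + `hC1_letter_ccmwCR` ((C1) with the cube∕floor `rfl`s, sign-free).  Callers `obtain ⟨hnum, hεreg, hBα, htI, htMS, hC1, hlf, hpq, hg, hbox⟩ := letters_ccmwCR hθ …`.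

EDITION v1.1 (2026-08-30, CLASS-S imports-only re-point): the umbrella import `Node00.N24ItemsStage13AtThm1CCMWOfStepRSignFreeAllTorusSepCoPH` (S2-campaign TIER 1b row 10d, re-keyed in place by
dag-n24-c) is replaced by the two lower modules this file actually reads — `Node00.Record13SignFreeComparabilityOfBetaBox` (the sign-free β-box ⇒ (hcomp) ∧ (hcompRev); its cone =
`Record13LettersOfThm1CCMW` ⊇ the numerics) and `Node00.Record13LiveSelectorFamily` (`theta13LiveOfNumerics`) — so that this file and the whole cR-lettered member cone above it depend on NO
`N24ItemsStage13*` module (post-seam: green as soon as TIER 1 rows 0–4 land, independent of TIER 1b).  Declarations byte-identical to v1.0.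

HONEST FRAMING.  Elementary real arithmetic on the definers' displayed numerals + applications BY NAME of dag-n21-c's θ-generic engines (A2ʷ letters, Dʷ β-box comparability); nothing of
Bałaban asserted; the β-box is a HYPOTHESIS of the last conjunct; NOT a re-pin (no `def`); N11 NOT discharged; K0⁷ stub 1 NOT closed; counts unmoved (typed 28∕28 · discharged 8∕27 · A 8∕28)
· K 1∕4.  One finite `𝕋⁴_{L^K}` programme at fixed `ε = L^{−K}`; R4 = the CONDITIONAL finite-𝕋⁴ rung `BalabanLadder.UV` only — NOT ℝ⁴, NOT OS, NOT the Yang–Mills mass gap (Clay).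
No `sorry`, `axiom`, `def`, `instance`, `notation`.  Sources (SHAPE only): [III] (2.1) p.254, (2.4)–(2.8) pp.255–256, (2.10) p.256, (2.12)–(2.13) pp.256–257, (2.28) p.259, (2.34)–(2.41)
p.261; [15] (7) p.278, Thm 1 (8) p.279; [I] Thm 1 p.259, (0.20) p.256, (1.12) p.262, (1.20)–(1.22) p.264; [6] (1.3)–(1.9) p.77.
-/

noncomputable section

open MeasureTheory
open scoped Matrix.Norms.L2Operator

namespace Summit.QuantumFields.YangMills.Theorems.BalabanUVNodesN11CRLetteredMemberLetters

open Literature.MathematicalPhysics.QuantumFieldTheory.Balaban1983to89 Node00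
open T4Continuum B14.Eq218Concrete B15DeterminingSets FlowStep FlowStepRuns B12RegularSpaces111 B14RegularSpaces234

variable {F : T4Family} {N : ℕ} [NeZero N] {j : ℕ} {γ c ε₀ ε₂₉ B₃ B₃' a₀ a₁ : ℝ} {θ : Stage13Params F N}

/-! ## §1  The rows, as `private` copies of ✓p620936 §1 (residue re-homing, №365) -/

section Letters

/-- `A₀ᶜᶜ¹ ≤ A₀∕8` and the two slack inequalities it yields: `8·A₀ᶜᶜ¹ ≤ a₁`, `8·(B₃·A₀ᶜᶜ¹) ≤ a₀`. [cite: Balaban1988Convergent, (2.4) p.255; Balaban1985Variational, (7) p.278, Thm 1 (8) p.279 (bookkeeping)] -/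
private theorem eight_mul_A0OfThm1CC1_le {L : ℕ} (hB : 0 ≤ B₃) (hB' : 0 ≤ B₃') (ha₀ : 0 ≤ a₀) (ha₁ : 0 ≤ a₁) :
    8 * A0OfThm1CC1 L B₃ B₃' a₀ a₁ ≤ a₁ ∧ 8 * (B₃ * A0OfThm1CC1 L B₃ B₃' a₀ a₁) ≤ a₀ := by
  have h1 : A0OfThm1CC1 L B₃ B₃' a₀ a₁ ≤ A0OfThm1C B₃ a₀ a₁ := A0OfThm1CC1_le hB hB' ha₀ ha₁
  have h2 : A0OfThm1C B₃ a₀ a₁ = A0OfThm1 B₃ a₀ a₁ / 8 := rfl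
  have h3 := A0OfThm1_le_a₁ hB ha₀ ha₁
  have h4 := mul_A0OfThm1_le_a₀ (a₁ := a₁) hB ha₀
  constructor
  · linarith
  · have := mul_le_mul_of_nonneg_left h1 hB
    rw [h2] at this
    linarith

/-- **(hnum) AT THE MEMBER** for `0 < c ≤ 8` along every windowed run (`γ ≤ ½`): `0 < c·ε_m`, `c·ε_m ≤ a₁`, `B₃·(c·ε_m) ≤ εreg = a₀` (`ε_m ≤ A₀ᶜᶜ¹`, the slack of `A₀ᶜ = A₀∕8`).
[cite: Balaban1988Convergent, (2.4) p.255, (2.10) p.256, (2.12) p.256; Balaban1985Variational, (7) p.278, Thm 1 (8) p.279] -/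
private theorem hnum_ccmwCR (hθ : θ = theta13LiveOfNumerics F N
      ({ stage12NumericsOfThm1CCMW F.L j γ ε₀ B₃ B₃' a₀ a₁ with s2 := { sect2NumericsOfThm1C F.L with cR := c } } : Stage12Numerics) ε₂₉
      (zeta316OfRecord F N (stage12NumericsOfThm1CCMW F.L j γ ε₀ B₃ B₃' a₀ a₁).ν (stage12NumericsOfThm1CCMW F.L j γ ε₀ B₃ B₃' a₀ a₁).τ9.M
        (stage12NumericsOfThm1CCMW F.L j γ ε₀ B₃ B₃' a₀ a₁).A₁) (RzOfRecord F N) (ZtOfRecord F N)) (hc0 : 0 < c) (hc8 : c ≤ 8) (hγ : γ ≤ 1 / 2) (hB : 0 ≤ B₃) (hB' : 0 ≤ B₃') (ha₀ : 0 < a₀) (ha₁ : 0 < a₁) :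
    ∀ (p : B12.RunParams) (n : ℕ), n ≤ p.K → Step.InInterval θ.γ n (gOfRecord₁₃ F N θ p) → ∀ m, m ≤ n →
      0 < θ.s2.cR * epsOfRecord θ.ν (gOfRecord₁₃ F N θ p) m ∧ θ.s2.cR * epsOfRecord θ.ν (gOfRecord₁₃ F N θ p) m ≤ a₁ ∧
        B₃ * (θ.s2.cR * epsOfRecord θ.ν (gOfRecord₁₃ F N θ p) m) ≤ θ.ν.εreg := by
  subst hθ
  intro p n _ hw m hm
  have hA0 : 0 ≤ A0OfThm1CC1 F.L B₃ B₃' a₀ a₁ := A0OfThm1CC1_nonneg hB hB' ha₀.le ha₁.le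
  have hApos : 0 < A0OfThm1CC1 F.L B₃ B₃' a₀ a₁ := A0OfThm1CC1_pos hB hB' ha₀ ha₁
  obtain ⟨h8a, h8b⟩ := eight_mul_A0OfThm1CC1_le (L := F.L) hB hB' ha₀.le ha₁.le
  have hle := epsOfRecord_le_A₀_of_p₀_eq_one (numerics7OfThm1CCM F.L j ε₀ B₃ B₃' a₀ a₁) rfl hA0 (hw m hm).1
  have hpos := epsOfRecord_pos (numerics7OfThm1CCM F.L j ε₀ B₃ B₃' a₀ a₁) hApos (hw m hm).1 ((hw m hm).2.trans_lt (hγ.trans_lt (by norm_num)))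
  change 0 < c * epsOfRecord (numerics7OfThm1CCM F.L j ε₀ B₃ B₃' a₀ a₁) _ m ∧ c * epsOfRecord (numerics7OfThm1CCM F.L j ε₀ B₃ B₃' a₀ a₁) _ m ≤ a₁ ∧
    B₃ * (c * epsOfRecord (numerics7OfThm1CCM F.L j ε₀ B₃ B₃' a₀ a₁) _ m) ≤ a₀
  change epsOfRecord (numerics7OfThm1CCM F.L j ε₀ B₃ B₃' a₀ a₁) _ m ≤ A0OfThm1CC1 F.L B₃ B₃' a₀ a₁ at hle
  refine ⟨mul_pos hc0 hpos, ?_, ?_⟩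
  · nlinarith
  · nlinarith [mul_le_mul_of_nonneg_left hle hB]

/-- `θ.ν.εreg ≤ a₀` at the member (it IS `a₀`). [cite: Balaban1985Variational, Thm 1 (8) p.279 (bookkeeping)] -/
private theorem εreg_le_ccmwCR (hθ : θ = theta13LiveOfNumerics F N
      ({ stage12NumericsOfThm1CCMW F.L j γ ε₀ B₃ B₃' a₀ a₁ with s2 := { sect2NumericsOfThm1C F.L with cR := c } } : Stage12Numerics) ε₂₉
      (zeta316OfRecord F N (stage12NumericsOfThm1CCMW F.L j γ ε₀ B₃ B₃' a₀ a₁).ν (stage12NumericsOfThm1CCMW F.L j γ ε₀ B₃ B₃' a₀ a₁).τ9.M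
        (stage12NumericsOfThm1CCMW F.L j γ ε₀ B₃ B₃' a₀ a₁).A₁) (RzOfRecord F N) (ZtOfRecord F N)) : θ.ν.εreg ≤ a₀ := by subst hθ; exact le_rfl

/-- The term-constant view `lfOfRecord₁₂` of the member IS that of `θ₁₅ᶜᶜᴹᵂ(j; γ)` (`rfl`; `c`-blind). [cite: Balaban1988Convergent, (2.28) p.259 (bookkeeping)] -/
private theorem lfOfRecord₁₂_ccmwCR (hθ : θ = theta13LiveOfNumerics F N
      ({ stage12NumericsOfThm1CCMW F.L j γ ε₀ B₃ B₃' a₀ a₁ with s2 := { sect2NumericsOfThm1C F.L with cR := c } } : Stage12Numerics) ε₂₉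
      (zeta316OfRecord F N (stage12NumericsOfThm1CCMW F.L j γ ε₀ B₃ B₃' a₀ a₁).ν (stage12NumericsOfThm1CCMW F.L j γ ε₀ B₃ B₃' a₀ a₁).τ9.M
        (stage12NumericsOfThm1CCMW F.L j γ ε₀ B₃ B₃' a₀ a₁).A₁) (RzOfRecord F N) (ZtOfRecord F N)) :
    lfOfRecord₁₂ F N θ.toStage12Params = lfOfRecord₁₂ F N (theta13OfThm1CCMW F N j γ ε₀ ε₂₉ B₃ B₃' a₀ a₁).toStage12Params := by subst hθ; rfl

/-- **`p₀ ≤ q₀` AT THE MEMBER** (`1 ≤ 2`; `c`-blind). [cite: Balaban1988Convergent, (2.4) p.255, (2.28) p.259 (bookkeeping)] -/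
private theorem hpq_ccmwCR (hθ : θ = theta13LiveOfNumerics F N
      ({ stage12NumericsOfThm1CCMW F.L j γ ε₀ B₃ B₃' a₀ a₁ with s2 := { sect2NumericsOfThm1C F.L with cR := c } } : Stage12Numerics) ε₂₉
      (zeta316OfRecord F N (stage12NumericsOfThm1CCMW F.L j γ ε₀ B₃ B₃' a₀ a₁).ν (stage12NumericsOfThm1CCMW F.L j γ ε₀ B₃ B₃' a₀ a₁).τ9.M
        (stage12NumericsOfThm1CCMW F.L j γ ε₀ B₃ B₃' a₀ a₁).A₁) (RzOfRecord F N) (ZtOfRecord F N)) : θ.ν.p₀ ≤ (lfOfRecord₁₂ F N θ.toStage12Params).q₀ := by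
  rw [lfOfRecord₁₂_ccmwCR hθ]; subst hθ
  exact hpq_theta13OfThm1CCMW (F := F) (N := N) (j := j) (γ := γ) (ε₀ := ε₀) (ε₂₉ := ε₂₉) (B₃ := B₃) (B₃' := B₃') (a₀ := a₀) (a₁ := a₁)

/-- **THE WINDOW LETTERS AT THE MEMBER** (`0 < g_m`, `g_m² ≤ e⁻¹`; `c`-blind — the generated couplings are `θ₁₅ᶜᶜᴹᵂ`'s by `rfl`). [cite: Balaban1987RG1, Thm 1 p.259; Balaban1988Convergent, (2.4) p.255 (bookkeeping)] -/
private theorem hg_ccmwCR (hθ : θ = theta13LiveOfNumerics F N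
      ({ stage12NumericsOfThm1CCMW F.L j γ ε₀ B₃ B₃' a₀ a₁ with s2 := { sect2NumericsOfThm1C F.L with cR := c } } : Stage12Numerics) ε₂₉
      (zeta316OfRecord F N (stage12NumericsOfThm1CCMW F.L j γ ε₀ B₃ B₃' a₀ a₁).ν (stage12NumericsOfThm1CCMW F.L j γ ε₀ B₃ B₃' a₀ a₁).τ9.M
        (stage12NumericsOfThm1CCMW F.L j γ ε₀ B₃ B₃' a₀ a₁).A₁) (RzOfRecord F N) (ZtOfRecord F N)) (hγ : γ ≤ 1 / 2) :
    ∀ (p : B12.RunParams) (n : ℕ), n ≤ p.K → Step.InInterval θ.γ n (gOfRecord₁₃ F N θ p) → ∀ m, m ≤ n →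
      0 < gOfRecord₁₃ F N θ p m ∧ gOfRecord₁₃ F N θ p m ^ 2 ≤ Real.exp (-1) := by
  subst hθ
  exact fun _ _ _ hw => window_sq_le_of_inInterval hγ hw

/-- **(C1) NESTED GRIDS AT THE MEMBER** (`R_m = L·t_m`; `c`-blind). [cite: Balaban1988Convergent, (2.5) p.255, p.257] -/
private theorem hC1_ccmwCR (hθ : θ = theta13LiveOfNumerics F N
      ({ stage12NumericsOfThm1CCMW F.L j γ ε₀ B₃ B₃' a₀ a₁ with s2 := { sect2NumericsOfThm1C F.L with cR := c } } : Stage12Numerics) ε₂₉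
      (zeta316OfRecord F N (stage12NumericsOfThm1CCMW F.L j γ ε₀ B₃ B₃' a₀ a₁).ν (stage12NumericsOfThm1CCMW F.L j γ ε₀ B₃ B₃' a₀ a₁).τ9.M
        (stage12NumericsOfThm1CCMW F.L j γ ε₀ B₃ B₃' a₀ a₁).A₁) (RzOfRecord F N) (ZtOfRecord F N)) (hγ : γ ≤ 1 / 2) :
    ∀ (p : B12.RunParams) (n : ℕ), n ≤ p.K → Step.InInterval θ.γ n (gOfRecord₁₃ F N θ p) → ∀ m, 1 ≤ m → m ≤ n →
      ∃ t : ℕ, 0 < t ∧ RkOfRecord (F.P p.K).L θ.ν.r (gOfRecord₁₃ F N θ p m) = (F.P p.K).L * t := by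
  subst hθ
  intro p n _ hw m _ hm
  have hL : 2 ≤ (F.P p.K).L := by show 2 ≤ F.L; have := F.hL11; omega
  exact exists_RkOfRecord_eq_mul hL (le_of_eq (rfl : (1 : ℕ) = _)) (one_lt_log_inv_sq_of_le_half (hw m hm).1 ((hw m hm).2.trans hγ))

/-- **(hBα) AT THE MEMBER** for `0 ≤ c ≤ 12` (`bg_numerics_of_letters`: `p₀ ≤ q₀`, `B₃·c·A₀ᶜᶜ¹ ≤ 12∕16 = ¾ = (1 − ¼)·C₀`, the window letters).
[cite: Balaban1988Convergent, (2.4) p.255, (2.28) p.259, (2.34) p.261] -/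
private theorem hBα_ccmwCR (hθ : θ = theta13LiveOfNumerics F N
      ({ stage12NumericsOfThm1CCMW F.L j γ ε₀ B₃ B₃' a₀ a₁ with s2 := { sect2NumericsOfThm1C F.L with cR := c } } : Stage12Numerics) ε₂₉
      (zeta316OfRecord F N (stage12NumericsOfThm1CCMW F.L j γ ε₀ B₃ B₃' a₀ a₁).ν (stage12NumericsOfThm1CCMW F.L j γ ε₀ B₃ B₃' a₀ a₁).τ9.M
        (stage12NumericsOfThm1CCMW F.L j γ ε₀ B₃ B₃' a₀ a₁).A₁) (RzOfRecord F N) (ZtOfRecord F N)) (hc0 : 0 ≤ c) (hc12 : c ≤ 12) (hγ : γ ≤ 1 / 2) (hB : 0 ≤ B₃) (hB' : 0 ≤ B₃') (ha₀ : 0 ≤ a₀) (ha₁ : 0 ≤ a₁) :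
    ∀ (p : B12.RunParams) (n : ℕ), n ≤ p.K → Step.InInterval θ.γ n (gOfRecord₁₃ F N θ p) → ∀ m, 1 ≤ m → m ≤ n →
      B₃ * (θ.s2.cR * epsOfRecord θ.ν (gOfRecord₁₃ F N θ p) m) ≤ (1 - θ.s2.βc) * (lfOfRecord₁₂ F N θ.toStage12Params).alpha0 (gOfRecord₁₃ F N θ p m) := by
  have hpq := hpq_ccmwCR hθ
  have hlf := lfOfRecord₁₂_ccmwCR hθ
  have hg := hg_ccmwCR hθ hγ
  subst hθ
  intro p n hn hw
  have hA0 : 0 ≤ A0OfThm1CC1 F.L B₃ B₃' a₀ a₁ := A0OfThm1CC1_nonneg hB hB' ha₀ ha₁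
  have h16 := mul_A0OfThm1CC1_le (L := F.L) hB hB' ha₀ ha₁
  refine Stage13Params.bg_numerics_of_letters _ hpq ?_ ?_ p n (hg p n hn hw)
  · change 0 ≤ B₃ * c * A0OfThm1CC1 F.L B₃ B₃' a₀ a₁
    positivity
  · rw [hlf, lfOfRecord₁₂_theta13OfThm1CCMW]
    change B₃ * c * A0OfThm1CC1 F.L B₃ B₃' a₀ a₁ ≤ (1 - 1 / 4) * _
    norm_num [lfConstsOfFamily, lfConstsOfRecord₁₂]
    nlinarith

/-- **★ THE I-FAMILY RADIUS LETTER (htI) AT THE MEMBER** for `0 ≤ c ≤ 192` (`gaugeLetter_of_numerics`: `B₃′·c·A₀ᶜᶜ¹ ≤ 1 ≤ c_B·C₀`, `B₃′·A₀ᶜᶜ¹ ≤ 1∕192`).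
[cite: Balaban1987RG1, (1.12) p.262; Balaban1988Convergent, (2.4) p.255, (2.28) p.259] -/
private theorem htI_ccmwCR (hθ : θ = theta13LiveOfNumerics F N
      ({ stage12NumericsOfThm1CCMW F.L j γ ε₀ B₃ B₃' a₀ a₁ with s2 := { sect2NumericsOfThm1C F.L with cR := c } } : Stage12Numerics) ε₂₉
      (zeta316OfRecord F N (stage12NumericsOfThm1CCMW F.L j γ ε₀ B₃ B₃' a₀ a₁).ν (stage12NumericsOfThm1CCMW F.L j γ ε₀ B₃ B₃' a₀ a₁).τ9.M
        (stage12NumericsOfThm1CCMW F.L j γ ε₀ B₃ B₃' a₀ a₁).A₁) (RzOfRecord F N) (ZtOfRecord F N)) (hc0 : 0 ≤ c) (hc : c ≤ 192) (hγ : γ ≤ 1 / 2) (hB : 0 ≤ B₃) (hB' : 0 ≤ B₃') (ha₀ : 0 ≤ a₀) (ha₁ : 0 ≤ a₁) :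
    ∀ (p : B12.RunParams) (n : ℕ), n ≤ p.K → Step.InInterval θ.γ n (gOfRecord₁₃ F N θ p) → ∀ m, 1 ≤ m → m ≤ n →
      B₃' * (θ.s2.cR * epsOfRecord θ.ν (gOfRecord₁₃ F N θ p) m) ≤ θ.s2.cB * (lfOfRecord₁₂ F N θ.toStage12Params).alpha0 (gOfRecord₁₃ F N θ p m) := by
  have hpq := hpq_ccmwCR hθ
  have hlf := lfOfRecord₁₂_ccmwCR hθ
  have hg := hg_ccmwCR hθ hγ
  subst hθ
  intro p n hn hw
  have hA0 : 0 ≤ A0OfThm1CC1 F.L B₃ B₃' a₀ a₁ := A0OfThm1CC1_nonneg hB hB' ha₀ ha₁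
  have h192 := gauge_mul_A0OfThm1CC1_le (L := F.L) F.hL.2.le hB hB' ha₀ ha₁
  have hL1 : (1 : ℝ) ≤ F.L := by exact_mod_cast F.hL.2.le
  refine gaugeLetter_of_numerics _ _ (fun m _ hm => hg p n hn hw m hm) hpq ?_ ?_
  · change 0 ≤ B₃' * c * A0OfThm1CC1 F.L B₃ B₃' a₀ a₁
    positivity
  · rw [hlf, lfOfRecord₁₂_theta13OfThm1CCMW]
    change B₃' * c * A0OfThm1CC1 F.L B₃ B₃' a₀ a₁ ≤ (6 * (F.L : ℝ) + 1) * _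
    norm_num [lfConstsOfFamily, lfConstsOfRecord₁₂]
    nlinarith

/-- **★ THE MS-FAMILY RADIUS LETTER (htMS) AT THE MEMBER** for `0 ≤ c ≤ 192` (`B₃′·c·A₀ᶜᶜ¹ ≤ 1 ≤ 7 = B·C·M_r·C₀`). [cite: Balaban1988Convergent, (2.38) p.261, (2.4) p.255, (2.28) p.259] -/
private theorem htMS_ccmwCR (hθ : θ = theta13LiveOfNumerics F N
      ({ stage12NumericsOfThm1CCMW F.L j γ ε₀ B₃ B₃' a₀ a₁ with s2 := { sect2NumericsOfThm1C F.L with cR := c } } : Stage12Numerics) ε₂₉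
      (zeta316OfRecord F N (stage12NumericsOfThm1CCMW F.L j γ ε₀ B₃ B₃' a₀ a₁).ν (stage12NumericsOfThm1CCMW F.L j γ ε₀ B₃ B₃' a₀ a₁).τ9.M
        (stage12NumericsOfThm1CCMW F.L j γ ε₀ B₃ B₃' a₀ a₁).A₁) (RzOfRecord F N) (ZtOfRecord F N)) (hc0 : 0 ≤ c) (hc : c ≤ 192) (hγ : γ ≤ 1 / 2) (hB : 0 ≤ B₃) (hB' : 0 ≤ B₃') (ha₀ : 0 ≤ a₀) (ha₁ : 0 ≤ a₁) :
    ∀ (p : B12.RunParams) (n : ℕ), n ≤ p.K → Step.InInterval θ.γ n (gOfRecord₁₃ F N θ p) → ∀ m, 1 ≤ m → m ≤ n →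
      B₃' * (θ.s2.cR * epsOfRecord θ.ν (gOfRecord₁₃ F N θ p) m) ≤ θ.s2.B * θ.s2.C * θ.s2.Mr * (lfOfRecord₁₂ F N θ.toStage12Params).alpha0 (gOfRecord₁₃ F N θ p m) := by
  have hpq := hpq_ccmwCR hθ
  have hlf := lfOfRecord₁₂_ccmwCR hθ
  have hg := hg_ccmwCR hθ hγ
  subst hθ
  intro p n hn hw
  have hA0 : 0 ≤ A0OfThm1CC1 F.L B₃ B₃' a₀ a₁ := A0OfThm1CC1_nonneg hB hB' ha₀ ha₁
  have h192 := gauge_mul_A0OfThm1CC1_le (L := F.L) F.hL.2.le hB hB' ha₀ ha₁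
  refine gaugeLetter_of_numerics _ _ (fun m _ hm => hg p n hn hw m hm) hpq ?_ ?_
  · change 0 ≤ B₃' * c * A0OfThm1CC1 F.L B₃ B₃' a₀ a₁
    positivity
  · rw [hlf, lfOfRecord₁₂_theta13OfThm1CCMW]
    change B₃' * c * A0OfThm1CC1 F.L B₃ B₃' a₀ a₁ ≤ 7 * 1 * 1 * _
    norm_num [lfConstsOfFamily, lfConstsOfRecord₁₂]
    nlinarith

/-- **(hcomp) AT THE MEMBER FROM (hcomp) AT `θ₁₅ᶜᶜᴹᵂ`** (`0 ≤ c`; the thresholds `ε_m` are `c`-blind — `rfl` — and (hcomp) is homogeneous in `cR`).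
[cite: Balaban1988Convergent, (2.4) p.255, (2.7)–(2.8) pp.255–256 (bookkeeping)] -/
private theorem hcomp_ccmwCR_of_ccmw (hθ : θ = theta13LiveOfNumerics F N
      ({ stage12NumericsOfThm1CCMW F.L j γ ε₀ B₃ B₃' a₀ a₁ with s2 := { sect2NumericsOfThm1C F.L with cR := c } } : Stage12Numerics) ε₂₉
      (zeta316OfRecord F N (stage12NumericsOfThm1CCMW F.L j γ ε₀ B₃ B₃' a₀ a₁).ν (stage12NumericsOfThm1CCMW F.L j γ ε₀ B₃ B₃' a₀ a₁).τ9.M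
        (stage12NumericsOfThm1CCMW F.L j γ ε₀ B₃ B₃' a₀ a₁).A₁) (RzOfRecord F N) (ZtOfRecord F N)) (hc0 : 0 ≤ c)
    (H : ∀ (p : B12.RunParams) (n : ℕ), n ≤ p.K → Step.InInterval (theta13OfThm1CCMW F N j γ ε₀ ε₂₉ B₃ B₃' a₀ a₁).γ n (gOfRecord₁₃ F N (theta13OfThm1CCMW F N j γ ε₀ ε₂₉ B₃ B₃' a₀ a₁) p) → ∀ m, m < n →
      (theta13OfThm1CCMW F N j γ ε₀ ε₂₉ B₃ B₃' a₀ a₁).s2.cR * epsOfRecord (theta13OfThm1CCMW F N j γ ε₀ ε₂₉ B₃ B₃' a₀ a₁).ν (gOfRecord₁₃ F N (theta13OfThm1CCMW F N j γ ε₀ ε₂₉ B₃ B₃' a₀ a₁) p) m ≤ 2 * ((theta13OfThm1CCMW F N j γ ε₀ ε₂₉ B₃ B₃' a₀ a₁).s2.cR * epsOfRecord (theta13OfThm1CCMW F N j γ ε₀ ε₂₉ B₃ B₃' a₀ a₁).ν (gOfRecord₁₃ F N (theta13OfThm1CCMW F N j γ ε₀ ε₂₉ B₃ B₃' a₀ a₁)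 p) (m + 1))) :
    ∀ (p : B12.RunParams) (n : ℕ), n ≤ p.K → Step.InInterval θ.γ n (gOfRecord₁₃ F N θ p) → ∀ m, m < n →
      θ.s2.cR * epsOfRecord θ.ν (gOfRecord₁₃ F N θ p) m ≤ 2 * (θ.s2.cR * epsOfRecord θ.ν (gOfRecord₁₃ F N θ p) (m + 1)) := by
  subst hθ
  intro p n hn hw m hm
  have h := H p n hn hw m hm
  rw [theta13OfThm1CCMW_cR, one_mul, one_mul] at h
  change c * epsOfRecord (theta13OfThm1CCMW F N j γ ε₀ ε₂₉ B₃ B₃' a₀ a₁).ν (gOfRecord₁₃ F N (theta13OfThm1CCMW F N j γ ε₀ ε₂₉ B₃ B₃' a₀ a₁) p) m ≤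
    2 * (c * epsOfRecord (theta13OfThm1CCMW F N j γ ε₀ ε₂₉ B₃ B₃' a₀ a₁).ν (gOfRecord₁₃ F N (theta13OfThm1CCMW F N j γ ε₀ ε₂₉ B₃ B₃' a₀ a₁) p) (m + 1))
  nlinarith [mul_le_mul_of_nonneg_left h hc0]

/-- **(hcompRev) AT THE MEMBER FROM (hcompRev) AT `θ₁₅ᶜᶜᴹᵂ`** (`0 ≤ c`). [cite: Balaban1988Convergent, (2.4) p.255, (2.7)–(2.8) pp.255–256 (bookkeeping)] -/
private theorem hcompRev_ccmwCR_of_ccmw (hθ : θ = theta13LiveOfNumerics F N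
      ({ stage12NumericsOfThm1CCMW F.L j γ ε₀ B₃ B₃' a₀ a₁ with s2 := { sect2NumericsOfThm1C F.L with cR := c } } : Stage12Numerics) ε₂₉
      (zeta316OfRecord F N (stage12NumericsOfThm1CCMW F.L j γ ε₀ B₃ B₃' a₀ a₁).ν (stage12NumericsOfThm1CCMW F.L j γ ε₀ B₃ B₃' a₀ a₁).τ9.M
        (stage12NumericsOfThm1CCMW F.L j γ ε₀ B₃ B₃' a₀ a₁).A₁) (RzOfRecord F N) (ZtOfRecord F N)) (hc0 : 0 ≤ c)
    (H : ∀ (p : B12.RunParams) (n : ℕ), n ≤ p.K → Step.InInterval (theta13OfThm1CCMW F N j γ ε₀ ε₂₉ B₃ B₃' a₀ a₁).γ n (gOfRecord₁₃ F N (theta13OfThm1CCMW F N j γ ε₀ ε₂₉ B₃ B₃' a₀ a₁) p) → ∀ m, m < n →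
      (theta13OfThm1CCMW F N j γ ε₀ ε₂₉ B₃ B₃' a₀ a₁).s2.cR * epsOfRecord (theta13OfThm1CCMW F N j γ ε₀ ε₂₉ B₃ B₃' a₀ a₁).ν (gOfRecord₁₃ F N (theta13OfThm1CCMW F N j γ ε₀ ε₂₉ B₃ B₃' a₀ a₁) p) (m + 1) ≤ 2 * ((theta13OfThm1CCMW F N j γ ε₀ ε₂₉ B₃ B₃' a₀ a₁).s2.cR * epsOfRecord (theta13OfThm1CCMW F N j γ ε₀ ε₂₉ B₃ B₃' a₀ a₁).ν (gOfRecord₁₃ F N (theta13OfThm1CCMW F N j γ ε₀ ε₂₉ B₃ B₃' a₀ a₁) p) m)) :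
    ∀ (p : B12.RunParams) (n : ℕ), n ≤ p.K → Step.InInterval θ.γ n (gOfRecord₁₃ F N θ p) → ∀ m, m < n →
      θ.s2.cR * epsOfRecord θ.ν (gOfRecord₁₃ F N θ p) (m + 1) ≤ 2 * (θ.s2.cR * epsOfRecord θ.ν (gOfRecord₁₃ F N θ p) m) := by
  subst hθ
  intro p n hn hw m hm
  have h := H p n hn hw m hm
  rw [theta13OfThm1CCMW_cR, one_mul, one_mul] at h
  change c * epsOfRecord (theta13OfThm1CCMW F N j γ ε₀ ε₂₉ B₃ B₃' a₀ a₁).ν (gOfRecord₁₃ F N (theta13OfThm1CCMW F N j γ ε₀ ε₂₉ B₃ B₃' a₀ a₁) p) (m + 1) ≤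
    2 * (c * epsOfRecord (theta13OfThm1CCMW F N j γ ε₀ ε₂₉ B₃ B₃' a₀ a₁).ν (gOfRecord₁₃ F N (theta13OfThm1CCMW F N j γ ε₀ ε₂₉ B₃ B₃' a₀ a₁) p) m)
  nlinarith [mul_le_mul_of_nonneg_left h hc0]

/-- **★ (hcomp) ∧ (hcompRev) AT THE MEMBER FROM THE SIGN-FREE WINDOWED β-BOX OF `betaOfRecord₁₃ F N θ₁₅ᶜᶜᴹᵂ(j; γ)`** — Dʷ `hcompBoth_theta13OfThm1CCMW_of_betaBoxSignFree` ∘ the rescaling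
(the β of record is `c`-blind: the box IS the member's). [cite: Balaban1987RG1, (0.20) p.256, (1.20)–(1.22) p.264; Balaban1988Convergent, (2.6)–(2.8) pp.255–256] -/
private theorem hcompBoth_ccmwCR_of_betaBoxSignFree (hθ : θ = theta13LiveOfNumerics F N
      ({ stage12NumericsOfThm1CCMW F.L j γ ε₀ B₃ B₃' a₀ a₁ with s2 := { sect2NumericsOfThm1C F.L with cR := c } } : Stage12Numerics) ε₂₉
      (zeta316OfRecord F N (stage12NumericsOfThm1CCMW F.L j γ ε₀ B₃ B₃' a₀ a₁).ν (stage12NumericsOfThm1CCMW F.L j γ ε₀ B₃ B₃' a₀ a₁).τ9.M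
        (stage12NumericsOfThm1CCMW F.L j γ ε₀ B₃ B₃' a₀ a₁).A₁) (RzOfRecord F N) (ZtOfRecord F N)) (hc0 : 0 ≤ c) (hγ : γ ≤ 1 / 2) (hB : 0 ≤ B₃) (hB' : 0 ≤ B₃') (ha₀ : 0 ≤ a₀) (ha₁ : 0 ≤ a₁)
    {bl β' : ℝ} (hbox : BetaLowerH bl γ (betaOfRecord₁₃ F N (theta13OfThm1CCMW F N j γ ε₀ ε₂₉ B₃ B₃' a₀ a₁)))
    (hbox' : BetaUpperH β' γ (betaOfRecord₁₃ F N (theta13OfThm1CCMW F N j γ ε₀ ε₂₉ B₃ B₃' a₀ a₁))) (hl : -bl * γ ^ 2 ≤ 3) (hβ' : β' * γ ^ 2 ≤ 3 / 4) :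
    (∀ (p : B12.RunParams) (n : ℕ), n ≤ p.K → Step.InInterval θ.γ n (gOfRecord₁₃ F N θ p) → ∀ m, m < n →
      θ.s2.cR * epsOfRecord θ.ν (gOfRecord₁₃ F N θ p) m ≤ 2 * (θ.s2.cR * epsOfRecord θ.ν (gOfRecord₁₃ F N θ p) (m + 1))) ∧
    (∀ (p : B12.RunParams) (n : ℕ), n ≤ p.K → Step.InInterval θ.γ n (gOfRecord₁₃ F N θ p) → ∀ m, m < n →
      θ.s2.cR * epsOfRecord θ.ν (gOfRecord₁₃ F N θ p) (m + 1) ≤ 2 * (θ.s2.cR * epsOfRecord θ.ν (gOfRecord₁₃ F N θ p) m)) :=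
  have H := hcompBoth_theta13OfThm1CCMW_of_betaBoxSignFree (F := F) (N := N) (j := j) (ε₀ := ε₀) (ε₂₉ := ε₂₉) hγ hB hB' ha₀ ha₁ hbox hbox' hl hβ'
  ⟨hcomp_ccmwCR_of_ccmw hθ hc0 H.1, hcompRev_ccmwCR_of_ccmw hθ hc0 H.2⟩

end Letters

/-! ## §2  The public BUNDLE of the member's letters (one conjunction; callers `obtain` the rows they need) -/

/-- **★ THE cR-LETTERED MEMBER's ROW-`bg` LETTERS, BUNDLED** (`0 < c ≤ 8`, `γ ≤ ½`, the signs): (hnum) · (εreg) · (hBα) · (htI) · (htMS) · (C1) · the term-constant view `lfOfRecord₁₂` is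
θ₁₅ᶜᶜᴹᵂ's · `p₀ ≤ q₀` · the window letters · and, from the SIGN-FREE windowed β-box of `betaOfRecord₁₃ F N θ₁₅ᶜᶜᴹᵂ(j; γ)`, (hcomp) ∧ (hcompRev) — exactly this seat's g4 ✓p620936 §1 letters
(`hnum ∕ εreg_le ∕ hBα ∕ htI ∕ htMS ∕ hC1 ∕ lfOfRecord₁₂ ∕ hpq ∕ hg_ccmwCR`, `hcompBoth_ccmwCR_of_betaBoxSignFree`), re-homed OUT of the Stage-2 residue module as ONE new statement (the
individual rows are `private` copies above, per the gate's `dedup.landed` rule for re-homed copies, k0-s1-w1 cell INBOX 2026-08-30 I.18016; director-ym №365 (2)∕(4)).  Elementary arithmetic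
on displayed numerals; nothing of Bałaban asserted. [cite: Balaban1988Convergent, (2.4)–(2.8) pp.255–256, (2.10) p.256, (2.12) p.256, (2.28) p.259, (2.34) p.261, (2.38) p.261, (2.5) p.255, p.257; Balaban1985Variational, (7) p.278, Thm 1 (8) p.279; Balaban1987RG1, Thm 1 p.259, (0.20) p.256, (1.12) p.262, (1.20)–(1.22) p.264] -/
theorem letters_ccmwCR (hθ : θ = theta13LiveOfNumerics F N
      ({ stage12NumericsOfThm1CCMW F.L j γ ε₀ B₃ B₃' a₀ a₁ with s2 := { sect2NumericsOfThm1C F.L with cR := c } } : Stage12Numerics) ε₂₉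
      (zeta316OfRecord F N (stage12NumericsOfThm1CCMW F.L j γ ε₀ B₃ B₃' a₀ a₁).ν (stage12NumericsOfThm1CCMW F.L j γ ε₀ B₃ B₃' a₀ a₁).τ9.M
        (stage12NumericsOfThm1CCMW F.L j γ ε₀ B₃ B₃' a₀ a₁).A₁) (RzOfRecord F N) (ZtOfRecord F N))
    (hc0 : 0 < c) (hc8 : c ≤ 8) (hγ : γ ≤ 1 / 2) (hB : 0 ≤ B₃) (hB' : 0 ≤ B₃') (ha₀ : 0 < a₀) (ha₁ : 0 < a₁) :
    (∀ (p : B12.RunParams) (n : ℕ), n ≤ p.K → Step.InInterval θ.γ n (gOfRecord₁₃ F N θ p) → ∀ m, m ≤ n →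
      0 < θ.s2.cR * epsOfRecord θ.ν (gOfRecord₁₃ F N θ p) m ∧ θ.s2.cR * epsOfRecord θ.ν (gOfRecord₁₃ F N θ p) m ≤ a₁ ∧ B₃ * (θ.s2.cR * epsOfRecord θ.ν (gOfRecord₁₃ F N θ p) m) ≤ θ.ν.εreg) ∧
    θ.ν.εreg ≤ a₀ ∧
    (∀ (p : B12.RunParams) (n : ℕ), n ≤ p.K → Step.InInterval θ.γ n (gOfRecord₁₃ F N θ p) → ∀ m, 1 ≤ m → m ≤ n →
      B₃ * (θ.s2.cR * epsOfRecord θ.ν (gOfRecord₁₃ F N θ p) m) ≤ (1 - θ.s2.βc) * (lfOfRecord₁₂ F N θ.toStage12Params).alpha0 (gOfRecord₁₃ F N θ p m)) ∧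
    (∀ (p : B12.RunParams) (n : ℕ), n ≤ p.K → Step.InInterval θ.γ n (gOfRecord₁₃ F N θ p) → ∀ m, 1 ≤ m → m ≤ n →
      B₃' * (θ.s2.cR * epsOfRecord θ.ν (gOfRecord₁₃ F N θ p) m) ≤ θ.s2.cB * (lfOfRecord₁₂ F N θ.toStage12Params).alpha0 (gOfRecord₁₃ F N θ p m)) ∧
    (∀ (p : B12.RunParams) (n : ℕ), n ≤ p.K → Step.InInterval θ.γ n (gOfRecord₁₃ F N θ p) → ∀ m, 1 ≤ m → m ≤ n →
      B₃' * (θ.s2.cR * epsOfRecord θ.ν (gOfRecord₁₃ F N θ p) m) ≤ θ.s2.B * θ.s2.C * θ.s2.Mr * (lfOfRecord₁₂ F N θ.toStage12Params).alpha0 (gOfRecord₁₃ F N θ p m)) ∧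
    (∀ (p : B12.RunParams) (n : ℕ), n ≤ p.K → Step.InInterval θ.γ n (gOfRecord₁₃ F N θ p) → ∀ m, 1 ≤ m → m ≤ n →
      ∃ t : ℕ, 0 < t ∧ RkOfRecord (F.P p.K).L θ.ν.r (gOfRecord₁₃ F N θ p m) = (F.P p.K).L * t) ∧
    lfOfRecord₁₂ F N θ.toStage12Params = lfOfRecord₁₂ F N (theta13OfThm1CCMW F N j γ ε₀ ε₂₉ B₃ B₃' a₀ a₁).toStage12Params ∧
    θ.ν.p₀ ≤ (lfOfRecord₁₂ F N θ.toStage12Params).q₀ ∧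
    (∀ (p : B12.RunParams) (n : ℕ), n ≤ p.K → Step.InInterval θ.γ n (gOfRecord₁₃ F N θ p) → ∀ m, m ≤ n → 0 < gOfRecord₁₃ F N θ p m ∧ gOfRecord₁₃ F N θ p m ^ 2 ≤ Real.exp (-1)) ∧
    (∀ {bl β' : ℝ}, BetaLowerH bl γ (betaOfRecord₁₃ F N (theta13OfThm1CCMW F N j γ ε₀ ε₂₉ B₃ B₃' a₀ a₁)) →
      BetaUpperH β' γ (betaOfRecord₁₃ F N (theta13OfThm1CCMW F N j γ ε₀ ε₂₉ B₃ B₃' a₀ a₁)) → -bl * γ ^ 2 ≤ 3 → β' * γ ^ 2 ≤ 3 / 4 →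
      (∀ (p : B12.RunParams) (n : ℕ), n ≤ p.K → Step.InInterval θ.γ n (gOfRecord₁₃ F N θ p) → ∀ m, m < n →
        θ.s2.cR * epsOfRecord θ.ν (gOfRecord₁₃ F N θ p) m ≤ 2 * (θ.s2.cR * epsOfRecord θ.ν (gOfRecord₁₃ F N θ p) (m + 1))) ∧
      (∀ (p : B12.RunParams) (n : ℕ), n ≤ p.K → Step.InInterval θ.γ n (gOfRecord₁₃ F N θ p) → ∀ m, m < n →
        θ.s2.cR * epsOfRecord θ.ν (gOfRecord₁₃ F N θ p) (m + 1) ≤ 2 * (θ.s2.cR * epsOfRecord θ.ν (gOfRecord₁₃ F N θ p) m))) :=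
  ⟨hnum_ccmwCR hθ hc0 hc8 hγ hB hB' ha₀ ha₁, εreg_le_ccmwCR hθ, hBα_ccmwCR hθ hc0.le (by linarith) hγ hB hB' ha₀.le ha₁.le,
    htI_ccmwCR hθ hc0.le (by linarith) hγ hB hB' ha₀.le ha₁.le, htMS_ccmwCR hθ hc0.le (by linarith) hγ hB hB' ha₀.le ha₁.le, hC1_ccmwCR hθ hγ,
    lfOfRecord₁₂_ccmwCR hθ, hpq_ccmwCR hθ, hg_ccmwCR hθ hγ,
    fun hbox hbox' hl hβ' => hcompBoth_ccmwCR_of_betaBoxSignFree hθ hc0.le hγ hB hB' ha₀.le ha₁.le hbox hbox' hl hβ'⟩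

/-- **★ (C1) ALONE at the member** (`γ ≤ ½` only — the guard-arithmetic lemmas `hAdm_gridGuard_…` need it without the sign letters): nested grids `R_m = L·t_m`. [cite: Balaban1988Convergent, (2.5) p.255, p.257] -/
theorem hC1_letter_ccmwCR (hθ : θ = theta13LiveOfNumerics F N
      ({ stage12NumericsOfThm1CCMW F.L j γ ε₀ B₃ B₃' a₀ a₁ with s2 := { sect2NumericsOfThm1C F.L with cR := c } } : Stage12Numerics) ε₂₉
      (zeta316OfRecord F N (stage12NumericsOfThm1CCMW F.L j γ ε₀ B₃ B₃' a₀ a₁).ν (stage12NumericsOfThm1CCMW F.L j γ ε₀ B₃ B₃' a₀ a₁).τ9.M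
        (stage12NumericsOfThm1CCMW F.L j γ ε₀ B₃ B₃' a₀ a₁).A₁) (RzOfRecord F N) (ZtOfRecord F N)) (hγ : γ ≤ 1 / 2) :
    (∀ (p : B12.RunParams) (n : ℕ), n ≤ p.K → Step.InInterval θ.γ n (gOfRecord₁₃ F N θ p) → ∀ m, 1 ≤ m → m ≤ n →
      ∃ t : ℕ, 0 < t ∧ RkOfRecord (F.P p.K).L θ.ν.r (gOfRecord₁₃ F N θ p m) = (F.P p.K).L * t) ∧ θ.τ9.M = F.L ^ j ∧ θ.ν.M₁ = F.L ^ j :=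
  ⟨hC1_ccmwCR hθ hγ, by subst hθ; rfl, by subst hθ; rfl⟩

end Summit.QuantumFields.YangMills.Theorems.BalabanUVNodesN11CRLetteredMemberLetters

end
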